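import Summits.KontsevichZagierPeriods.Zeta5Search.Certificates.VIML3Fin00
import Summits.KontsevichZagierPeriods.Zeta5Search.Certificates.VIML3Fin01
import Summits.KontsevichZagierPeriods.Zeta5Search.Certificates.VIML3Fin10
import Summits.KontsevichZagierPeriods.Zeta5Search.Certificates.VIML3Fin11
import Summits.KontsevichZagierPeriods.Zeta5Search.Certificates.VIML3Fin20
import Summits.KontsevichZagierPeriods.Zeta5Search.Certificates.VIML3Fin21
import HarnessLib

/-!
# ζ(5) search — brown9 LEVEL 3: the cleared termwise identity of the creative-telescoping certificate (cell `pub-zeta5`, certifier `cert-1`)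

HONEST FRAMING: systematic search; recurrence certificates; no irrationality claim unless certified.

**`termwise_cleared`**: for `n ≥ 3` with (L-K3), (L-NK) available from level `n` on (`LK3At`, `LNKAt` hypotheses; (R-K2), (R-NK) are
tree theorems) and every rational `x` with `x + 7 < 2n`:
`(x+1)·d(n)·D(n,x)·D(n,x+1) · Σ_{i=0}^{4} P_i(n) π_i(n,x) L(n+i,x) R(n+i,x)
   + (n+4−x)·N₄·D(n,x) · Σ_{a≤2,b≤1} M_ab(n,x+1) L(n,x+1+a) R(n,x+1+b) + (x+1)·N₄·D(n,x+1) · Σ_{ab} M_ab(n,x) L(n,x+a) R(n,x+b) = 0`,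
all polynomial atoms as values of their reflected trees (`VIML3FinData`, `VIML3CertM*`). Proof: multiply by `Λ_L Λ_R ≠ 0`, substitute
the ten transfer lemmas (`VIML3Transfer*`) and the ten cofactor identities, and the six kernel-checked coordinate identities
`fin00 … fin21` (`VIML3Fin*`) are exactly the coefficients of `L(n,x+a')R(n,x+b')`. This is the divided-difference form of
`Σ_i P_i(n) t(n+i,k₃) = G(n,k₃+1) − G(n,k₃)`; the summation over `k₃` is `VIML3Sum`. No named facts.
-/

namespace Summit.KontsevichZagierPeriods.Zeta5Search.Certificates

namespace VIMInner.L3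

open PolyReflect
open Lean.Grind.CommRing (Expr)
open Families.CellularVIMRecurrenceLaws (P evalList)

/-- **The cleared termwise identity** of the level-3 certificate (see the module docstring). -/
theorem termwise_cleared (n : ℕ) (hn : 3 ≤ n) (hK : ∀ m, n ≤ m → LK3At m) (hN : ∀ m, n ≤ m → LNKAt m) (x : ℚ)
    (hx : x + 7 < 2 * (n : ℚ)) :
    peval eXp1 (V n x) * peval eDn (V n x) * peval eDc (V n x) * peval eDcp (V n x) * (peval ePl_0 (V n x) * peval ePi_0 (V n x) * (Lsum n x * Rsum n x) + peval ePl_1 (V n x) * peval ePi_1 (V n x) * (Lsum (n + 1) x * Rsum (n + 1) x) + peval ePl_2 (V n x) * peval ePi_2 (V n x) * (Lsum (n + 2) x * Rsum (n + 2) x) + peval ePl_3 (V n x) * peval ePi_3 (V n x) * (Lsum (n + 3) x * Rsum (n + 3) x) + peval ePl_4 (V n x) * peval ePi_4 (V n x) * (Lsum (n + 4) x * Rsum (n + 4) x))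
    + peval eN4mx (V n x) * peval eN4 (V n x) * peval eDc (V n x) * (peval (substs (τ ((0 : ℕ) : ℤ) (1 : ℤ)) eM00) (V n x) * (Lsum n (x + 1) * Rsum n (x + 1)) + peval (substs (τ ((0 : ℕ) : ℤ) (1 : ℤ)) eM01) (V n x) * (Lsum n (x + 1) * Rsum n (x + 2)) + peval (substs (τ ((0 : ℕ) : ℤ) (1 : ℤ)) eM10) (V n x) * (Lsum n (x + 2) * Rsum n (x + 1)) + peval (substs (τ ((0 : ℕ) : ℤ) (1 : ℤ)) eM11) (V n x) * (Lsum n (x + 2) * Rsum n (x + 2)) + peval (substs (τ ((0 : ℕ) : ℤ) (1 : ℤ)) eM20) (V n x) * (Lsum n (x + 3) * Rsum n (x + 1)) + peval (substs (τ ((0 : ℕ) : ℤ) (1 : ℤ)) eM21) (V n x) * (Lsum n (x + 3) * Rsum n (x + 2)))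
    + peval eXp1 (V n x) * peval eN4 (V n x) * peval eDcp (V n x) * (peval eM00 (V n x) * (Lsum n x * Rsum n x) + peval eM01 (V n x) * (Lsum n x * Rsum n (x + 1)) + peval eM10 (V n x) * (Lsum n (x + 1) * Rsum n x) + peval eM11 (V n x) * (Lsum n (x + 1) * Rsum n (x + 1)) + peval eM20 (V n x) * (Lsum n (x + 2) * Rsum n x) + peval eM21 (V n x) * (Lsum n (x + 2) * Rsum n (x + 1))) = 0 := by
  have hL1 := trL_1_0 n hN x hx
  have hL2 := trL_2_0 n hK hN x hx
  have hL3 := trL_3_0 n hK hN x hx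
  have hL4 := trL_4_0 n hK hN x hx
  have hR1 := trR_1_0 n hn x hx
  have hR2 := trR_2_0 n hn x hx
  have hR3 := trR_3_0 n hn x hx
  have hR4 := trR_4_0 n hn x hx
  have hK3 := trL_0_3 n hK x hx
  have hK2 := trR_0_2 n hn x hx
  have hcofL_1 := cofL_1_mul n x
  have hcofL_2 := cofL_2_mul n x
  have hcofL_3 := cofL_3_mul n x
  have hcofL_4 := cofL_4_mul n x
  have hcofR_1 := cofR_1_mul n x
  have hcofR_2 := cofR_2_mul n x
  have hcofR_3 := cofR_3_mul n x
  have hcofR_4 := cofR_4_mul n x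
  have hcofK3 := cofK3_mul n x
  have hcofK2 := cofK2_mul n x
  have f00 := fin00 n x
  simp only [eFIN00, peval_add, peval_mul] at f00
  have f01 := fin01 n x
  simp only [eFIN01, peval_add, peval_mul] at f01
  have f10 := fin10 n x
  simp only [eFIN10, peval_add, peval_mul] at f10
  have f11 := fin11 n x
  simp only [eFIN11, peval_add, peval_mul] at f11
  have f20 := fin20 n x
  simp only [eFIN20, peval_add, peval_mul] at f20
  have f21 := fin21 n x
  simp only [eFIN21, peval_add, peval_mul] at f21
  apply mul_left_cancel₀ (Lam_ne n x hx)
  linear_combination ((peval eXp1 (V n x) * peval eDn (V n x) * peval eDc (V n x) * peval eDcp (V n x) * peval ePl_1 (V n x) * peval ePi_1 (V n x)) * peval cofL_1 (V n x) * peval cofR_1 (V n x) * (peval dR_1_0 (V n x) * Rsum (n + 1) x)) * hL1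
    + ((peval eXp1 (V n x) * peval eDn (V n x) * peval eDc (V n x) * peval eDcp (V n x) * peval ePl_1 (V n x) * peval ePi_1 (V n x)) * peval cofL_1 (V n x) * peval cofR_1 (V n x) * (peval cL_1_0_0 (V n x) * Lsum n x + peval cL_1_0_1 (V n x) * Lsum n (x + 1) + peval cL_1_0_2 (V n x) * Lsum n (x + 2))) * hR1
    -  ((peval eXp1 (V n x) * peval eDn (V n x) * peval eDc (V n x) * peval eDcp (V n x) * peval ePl_1 (V n x) * peval ePi_1 (V n x)) * peval cofL_1 (V n x) * peval dL_1_0 (V n x) * Lsum (n + 1) x * Rsum (n + 1) x) * hcofR_1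
    -  (peval eLamR (V n x) * (peval eXp1 (V n x) * peval eDn (V n x) * peval eDc (V n x) * peval eDcp (V n x) * peval ePl_1 (V n x) * peval ePi_1 (V n x)) * Lsum (n + 1) x * Rsum (n + 1) x) * hcofL_1
    + ((peval eXp1 (V n x) * peval eDn (V n x) * peval eDc (V n x) * peval eDcp (V n x) * peval ePl_2 (V n x) * peval ePi_2 (V n x)) * peval cofL_2 (V n x) * peval cofR_2 (V n x) * (peval dR_2_0 (V n x) * Rsum (n + 2) x)) * hL2
    + ((peval eXp1 (V n x) * peval eDn (V n x) * peval eDc (V n x) * peval eDcp (V n x) * peval ePl_2 (V n x) * peval ePi_2 (V n x)) * peval cofL_2 (V n x) * peval cofR_2 (V n x) * (peval cL_2_0_0 (V n x) * Lsum n x + peval cL_2_0_1 (V n x) * Lsum n (x + 1) + peval cL_2_0_2 (V n x) * Lsum n (x + 2))) * hR2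
    -  ((peval eXp1 (V n x) * peval eDn (V n x) * peval eDc (V n x) * peval eDcp (V n x) * peval ePl_2 (V n x) * peval ePi_2 (V n x)) * peval cofL_2 (V n x) * peval dL_2_0 (V n x) * Lsum (n + 2) x * Rsum (n + 2) x) * hcofR_2
    -  (peval eLamR (V n x) * (peval eXp1 (V n x) * peval eDn (V n x) * peval eDc (V n x) * peval eDcp (V n x) * peval ePl_2 (V n x) * peval ePi_2 (V n x)) * Lsum (n + 2) x * Rsum (n + 2) x) * hcofL_2
    + ((peval eXp1 (V n x) * peval eDn (V n x) * peval eDc (V n x) * peval eDcp (V n x) * peval ePl_3 (V n x) * peval ePi_3 (V n x)) * peval cofL_3 (V n x) * peval cofR_3 (V n x) * (peval dR_3_0 (V n x) * Rsum (n + 3) x)) * hL3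
    + ((peval eXp1 (V n x) * peval eDn (V n x) * peval eDc (V n x) * peval eDcp (V n x) * peval ePl_3 (V n x) * peval ePi_3 (V n x)) * peval cofL_3 (V n x) * peval cofR_3 (V n x) * (peval cL_3_0_0 (V n x) * Lsum n x + peval cL_3_0_1 (V n x) * Lsum n (x + 1) + peval cL_3_0_2 (V n x) * Lsum n (x + 2))) * hR3
    -  ((peval eXp1 (V n x) * peval eDn (V n x) * peval eDc (V n x) * peval eDcp (V n x) * peval ePl_3 (V n x) * peval ePi_3 (V n x)) * peval cofL_3 (V n x) * peval dL_3_0 (V n x) * Lsum (n + 3) x * Rsum (n + 3) x) * hcofR_3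
    -  (peval eLamR (V n x) * (peval eXp1 (V n x) * peval eDn (V n x) * peval eDc (V n x) * peval eDcp (V n x) * peval ePl_3 (V n x) * peval ePi_3 (V n x)) * Lsum (n + 3) x * Rsum (n + 3) x) * hcofL_3
    + ((peval eXp1 (V n x) * peval eDn (V n x) * peval eDc (V n x) * peval eDcp (V n x) * peval ePl_4 (V n x) * peval ePi_4 (V n x)) * peval cofL_4 (V n x) * peval cofR_4 (V n x) * (peval dR_4_0 (V n x) * Rsum (n + 4) x)) * hL4
    + ((peval eXp1 (V n x) * peval eDn (V n x) * peval eDc (V n x) * peval eDcp (V n x) * peval ePl_4 (V n x) * peval ePi_4 (V n x)) * peval cofL_4 (V n x) * peval cofR_4 (V n x) * (peval cL_4_0_0 (V n x) * Lsum n x + peval cL_4_0_1 (V n x) * Lsum n (x + 1) + peval cL_4_0_2 (V n x) * Lsum n (x + 2))) * hR4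
    -  ((peval eXp1 (V n x) * peval eDn (V n x) * peval eDc (V n x) * peval eDcp (V n x) * peval ePl_4 (V n x) * peval ePi_4 (V n x)) * peval cofL_4 (V n x) * peval dL_4_0 (V n x) * Lsum (n + 4) x * Rsum (n + 4) x) * hcofR_4
    -  (peval eLamR (V n x) * (peval eXp1 (V n x) * peval eDn (V n x) * peval eDc (V n x) * peval eDcp (V n x) * peval ePl_4 (V n x) * peval ePi_4 (V n x)) * Lsum (n + 4) x * Rsum (n + 4) x) * hcofL_4
    + (peval eLamR (V n x) * (peval eN4mx (V n x) * peval eN4 (V n x) * peval eDc (V n x)) * peval (substs (τ ((0 : ℕ) : ℤ) (1 : ℤ)) eM20) (V n x) * Rsum n (x + 1) * peval cofK3 (V n x)) * hK3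
    -  (peval eLamR (V n x) * (peval eN4mx (V n x) * peval eN4 (V n x) * peval eDc (V n x)) * peval (substs (τ ((0 : ℕ) : ℤ) (1 : ℤ)) eM20) (V n x) * Lsum n (x + 3) * Rsum n (x + 1)) * hcofK3
    + (peval eLamL (V n x) * (peval eN4mx (V n x) * peval eN4 (V n x) * peval eDc (V n x)) * peval (substs (τ ((0 : ℕ) : ℤ) (1 : ℤ)) eM01) (V n x) * Lsum n (x + 1) * peval cofK2 (V n x)) * hK2
    -  (peval eLamL (V n x) * (peval eN4mx (V n x) * peval eN4 (V n x) * peval eDc (V n x)) * peval (substs (τ ((0 : ℕ) : ℤ) (1 : ℤ)) eM01) (V n x) * Lsum n (x + 1) * Rsum n (x + 2)) * hcofK2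
    + (peval eLamL (V n x) * (peval eN4mx (V n x) * peval eN4 (V n x) * peval eDc (V n x)) * peval (substs (τ ((0 : ℕ) : ℤ) (1 : ℤ)) eM11) (V n x) * Lsum n (x + 2) * peval cofK2 (V n x)) * hK2
    -  (peval eLamL (V n x) * (peval eN4mx (V n x) * peval eN4 (V n x) * peval eDc (V n x)) * peval (substs (τ ((0 : ℕ) : ℤ) (1 : ℤ)) eM11) (V n x) * Lsum n (x + 2) * Rsum n (x + 2)) * hcofK2
    + ((peval eN4mx (V n x) * peval eN4 (V n x) * peval eDc (V n x)) * peval (substs (τ ((0 : ℕ) : ℤ) (1 : ℤ)) eM21) (V n x) * peval cofK3 (V n x) * peval cofK2 (V n x) * (peval dR_0_2 (V n x) * Rsum n (x + 2))) * hK3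
    + ((peval eN4mx (V n x) * peval eN4 (V n x) * peval eDc (V n x)) * peval (substs (τ ((0 : ℕ) : ℤ) (1 : ℤ)) eM21) (V n x) * peval cofK3 (V n x) * peval cofK2 (V n x) * (peval cL_0_3_0 (V n x) * Lsum n x + peval cL_0_3_1 (V n x) * Lsum n (x + 1) + peval cL_0_3_2 (V n x) * Lsum n (x + 2))) * hK2
    -  ((peval eN4mx (V n x) * peval eN4 (V n x) * peval eDc (V n x)) * peval (substs (τ ((0 : ℕ) : ℤ) (1 : ℤ)) eM21) (V n x) * peval cofK3 (V n x) * peval dL_0_3 (V n x) * Lsum n (x + 3) * Rsum n (x + 2)) * hcofK2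
    -  (peval eLamR (V n x) * (peval eN4mx (V n x) * peval eN4 (V n x) * peval eDc (V n x)) * peval (substs (τ ((0 : ℕ) : ℤ) (1 : ℤ)) eM21) (V n x) * Lsum n (x + 3) * Rsum n (x + 2)) * hcofK3
    + (Lsum n x * Rsum n x) * f00
    + (Lsum n x * Rsum n (x + 1)) * f01
    + (Lsum n (x + 1) * Rsum n x) * f10
    + (Lsum n (x + 1) * Rsum n (x + 1)) * f11
    + (Lsum n (x + 2) * Rsum n x) * f20
    + (Lsum n (x + 2) * Rsum n (x + 1)) * f21

end VIMInner.L3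

end Summit.KontsevichZagierPeriods.Zeta5Search.Certificates
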